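import Literature.Analysis.Matrix.FiniteRangeDecompositionQuasi1DPointwise
import HarnessLib

/-!
# Finite-range decomposition with smoother pieces, V: the quasi-one-dimensional regime —
# counting and the off-zero-mode shells

`Literature/Analysis/Matrix/`; sums the pointwise dominations of part IV
(`FiniteRangeDecompositionQuasi1DPointwise.lean`) over the characters of the abstract
three-dimensional torus of parts II–III (`G`, steps `e₀,e₁,e₂` of orders dividing `L₀,L₁,L₂` which
determine the characters, `|G| ≥ L₀L₁L₂`, a translation-invariant symmetric `A ≤ 4` with
`c₀ Σ_i (2 − 2Re ψ(e_i)) ≤ σ_A(ψ)`), in the **quasi-one-dimensional regime**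

  `L₀ = L₁ = L ≤ 2^N ≤ L₂`

of the anisotropic space-time torus `(ℤ/L)² × ℤ/M`, `M ≥ 2^N ≥ L` (the scales of the dyadic
finite-range decomposition lying between the spatial and the temporal size).  For the power-`m`
pieces `C^{(m)}_N = frdPiecePow A m N` and a list `l` of `k` steps with `k + 2 ≤ 2m`:

* `avg_gradSymbol_frdPiecePow_le_quasi1D_spatial`, `abs_rowDiffs_frdPiecePow_apply_le_quasi1D_spatial`
  (**a difference in a spatial direction is suppressed beyond the spatial size**): if `l` contains
  one of `±e₀, ±e₁`,
  `|∇_l C^{(m)}_N(x,y)| ≤ K₁(m,k,c₀) · (L/2^N)^{2m} / L^{k+1}`,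
  `K₁ = 27m(2π)^kπ^{2m+2}2^{k+4}/(4(16c₀)^{m+1})` — only the characters with a non-zero spatial
  momentum (`≥ 1/L`) contribute, in the dyadic shells at scale `1/L` (`shellTerm_le` with `2^N ↦ L`);
* `avg_gradSymbol_frdPiecePow_le_quasi1D_temporal`, `abs_rowDiffs_frdPiecePow_apply_le_quasi1D_temporal`
  (**purely temporal differences scale one-dimensionally with the prefactor `1/L²`**): if every step
  of `l` is `±e₂`,
  `|∇_l C^{(m)}_N(x,y)| ≤ K₂(m,k,c₀) · 2^N / ((2^N)^k L²)`,
  `K₂ = (27m(2π)^k/4)(1 + 5·2^{k+2}π^{2m+2}/(16c₀)^{m+1})` — the spatial zero modes form a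
  one-dimensional family counted by `27ρ/L²` per unit of temporal momentum (`card_filter_momentum_lt_le'`,
  a momentum box with a radius per direction), plus the off-zero-mode part.

This file carries the COUNTING layer: the momentum box with a radius per direction
(`card_filter_momentum_lt_le'`), the spatial zero modes in a temporal momentum window
(`inv_card_mul_card_zeroMode_le`: `|G|⁻¹ #{idx₀ = idx₁ = 0, |t₂| < ρ} ≤ 27ρ/L²`) and the summed
off-zero-mode shells (`offZero_shellSum_le`: `≤ 2C₁ (L/2^N)^{2m}/L^{k+1}`, `shellTerm_le` at scale `L`
times the symbol ratio `(L/2^N)^{2m}`); the two averaged bounds displayed above and the kernel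
bounds are assembled in `FiniteRangeDecompositionQuasi1DBounds.lean`.  All [folklore]; the exponents
are the `d_eff = 1` rows of the scaling table of [cite: Bauerschmidt2013, (1.10)].
-/

noncomputable section

open Finset Real
open Literature.Analysis.Fourier Literature.Analysis.Fourier.TrigApprox

namespace Literature.Analysis.Matrix

variable {G : Type*} [AddCommGroup G] [Fintype G] [DecidableEq G]

/-! ### Counting characters in a momentum box with a radius per direction -/

omit [DecidableEq G] in
/-- **Box count**: `#{ψ : |t_i(ψ)| < ρ_i ∀ i} ≤ Π_i (2 L_i ρ_i + 1)` when characters are determined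
by their values on the `e_i`. [folklore] -/
theorem card_filter_momentum_lt_le' {d : ℕ} (e : Fin d → G) (Ls : Fin d → ℕ) (hL : ∀ i, Ls i ≠ 0)
    (he : ∀ i, Ls i • e i = 0) (hgen : ∀ ψ φ : AddChar G ℂ, (∀ i, ψ (e i) = φ (e i)) → ψ = φ)
    {ρ : Fin d → ℝ} (hρ : ∀ i, 0 < ρ i) :
    ((Finset.univ.filter fun ψ : AddChar G ℂ =>
        ∀ i, |addCharMomentum (Ls i) (e i) ψ| < ρ i).card : ℝ)
      ≤ ∏ i, (2 * (Ls i : ℝ) * ρ i + 1) := by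
  classical
  set K : Fin d → ℤ := fun i => ⌈(Ls i : ℝ) * ρ i⌉ with hK
  set f : AddChar G ℂ → (Fin d → ℤ) := fun ψ i => addCharIndex (Ls i) (e i) ψ with hf
  set S := Finset.univ.filter fun ψ : AddChar G ℂ =>
    ∀ i, |addCharMomentum (Ls i) (e i) ψ| < ρ i with hS
  set T := Fintype.piFinset fun i => Finset.Ioo (-K i) (K i) with hT
  have hmaps : ∀ ψ ∈ S, f ψ ∈ T := by
    intro ψ hψ
    rw [hS, Finset.mem_filter] at hψ
    rw [hT, Fintype.mem_piFinset]
    intro i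
    have hlt := abs_addCharIndex_lt (hL i) ψ (hψ.2 i)
    have hceil : (Ls i : ℝ) * ρ i ≤ (K i : ℝ) := Int.le_ceil _
    have habs : |(addCharIndex (Ls i) (e i) ψ : ℝ)| < K i := lt_of_lt_of_le hlt hceil
    rw [abs_lt] at habs
    rw [Finset.mem_Ioo]
    constructor
    · exact_mod_cast habs.1
    · exact_mod_cast habs.2
  have hinj : Set.InjOn f S := by
    intro ψ _ φ _ hψφ
    apply hgen
    intro i
    exact addChar_apply_eq_of_index_eq (hL i) (he i) ψ φ (congrFun hψφ i)
  have hcard := Finset.card_le_card_of_injOn f hmaps hinj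
  have hT' : (T.card : ℝ) ≤ ∏ i, (2 * (Ls i : ℝ) * ρ i + 1) := by
    rw [hT, Fintype.card_piFinset]
    push_cast
    refine Finset.prod_le_prod (fun i _ => by positivity) fun i _ => ?_
    have hKpos : 0 < K i :=
      Int.ceil_pos.mpr (mul_pos (Nat.cast_pos.mpr (Nat.pos_of_ne_zero (hL i))) (hρ i))
    have hcardI : ((Finset.Ioo (-K i) (K i)).card : ℝ) = 2 * (K i : ℝ) - 1 := by
      have h := Int.card_Ioo_of_lt (-K i) (K i) (by omega)
      have h' : (((Finset.Ioo (-K i) (K i)).card : ℤ) : ℝ) = ((K i - -K i - 1 : ℤ) : ℝ) := by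
        exact_mod_cast h
      push_cast at h'
      linarith
    rw [hcardI]
    have hceil : (K i : ℝ) < (Ls i : ℝ) * ρ i + 1 := Int.ceil_lt_add_one _
    linarith
  calc (S.card : ℝ) ≤ T.card := by exact_mod_cast hcard
    _ ≤ _ := hT'


/-! ### Counting the spatial zero modes -/

omit [DecidableEq G] in
/-- **The spatial zero modes in a temporal momentum window**: if `L₀ = L₁ = L`, `|G| ≥ L·L·L₂` and
`1/L₂ ≤ ρ`, then `|G|⁻¹ #{ψ : idx₀(ψ) = idx₁(ψ) = 0, |t₂(ψ)| < ρ} ≤ 27ρ/L²`. [folklore] -/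
theorem inv_card_mul_card_zeroMode_le (e : Fin 3 → G) (Ls : Fin 3 → ℕ) (hL : ∀ i, Ls i ≠ 0)
    (he : ∀ i, Ls i • e i = 0) (hgen : ∀ ψ φ : AddChar G ℂ, (∀ i, ψ (e i) = φ (e i)) → ψ = φ)
    (hcard : ∏ i, (Ls i : ℝ) ≤ Fintype.card G) (hL01 : Ls 1 = Ls 0) {ρ : ℝ}
    (hρ : 1 / (Ls 2 : ℝ) ≤ ρ) :
    (Fintype.card G : ℝ)⁻¹ * ((Finset.univ.filter fun ψ : AddChar G ℂ =>
        addCharIndex (Ls 0) (e 0) ψ = 0 ∧ addCharIndex (Ls 1) (e 1) ψ = 0 ∧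
          |addCharMomentum (Ls 2) (e 2) ψ| < ρ).card : ℝ)
      ≤ 27 * ρ / (Ls 0 : ℝ) ^ 2 := by
  classical
  have hLr : ∀ i, (0 : ℝ) < Ls i := fun i => Nat.cast_pos.mpr (Nat.pos_of_ne_zero (hL i))
  have hρ0 : 0 < ρ := lt_of_lt_of_le (by have := hLr 2; positivity) hρ
  -- the radii `(1/L, 1/L, ρ)`
  set r : Fin 3 → ℝ := ![1 / (Ls 0 : ℝ), 1 / (Ls 1 : ℝ), ρ] with hr
  have hrpos : ∀ i, 0 < r i := by
    intro i; fin_cases i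
    · show 0 < 1 / (Ls 0 : ℝ); exact div_pos one_pos (hLr 0)
    · show 0 < 1 / (Ls 1 : ℝ); exact div_pos one_pos (hLr 1)
    · show 0 < ρ; exact hρ0
  have hsub : (Finset.univ.filter fun ψ : AddChar G ℂ =>
        addCharIndex (Ls 0) (e 0) ψ = 0 ∧ addCharIndex (Ls 1) (e 1) ψ = 0 ∧
          |addCharMomentum (Ls 2) (e 2) ψ| < ρ)
      ⊆ Finset.univ.filter fun ψ : AddChar G ℂ => ∀ i, |addCharMomentum (Ls i) (e i) ψ| < r i := by
    intro ψ hψ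
    rw [Finset.mem_filter] at hψ ⊢
    refine ⟨hψ.1, fun i => ?_⟩
    fin_cases i
    · show |addCharMomentum (Ls 0) (e 0) ψ| < 1 / (Ls 0 : ℝ)
      rw [addCharMomentum_eq_zero_of_index_eq_zero ψ hψ.2.1, abs_zero]
      exact div_pos one_pos (hLr 0)
    · show |addCharMomentum (Ls 1) (e 1) ψ| < 1 / (Ls 1 : ℝ)
      rw [addCharMomentum_eq_zero_of_index_eq_zero ψ hψ.2.2.1, abs_zero]
      exact div_pos one_pos (hLr 1)
    · show |addCharMomentum (Ls 2) (e 2) ψ| < ρ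
      exact hψ.2.2.2
  have hcount := card_filter_momentum_lt_le' e Ls hL he hgen hrpos
  have hprod : ∏ i, (2 * (Ls i : ℝ) * r i + 1) = 3 * 3 * (2 * (Ls 2 : ℝ) * ρ + 1) := by
    rw [Fin.prod_univ_three]
    have h0 : 2 * (Ls 0 : ℝ) * r 0 + 1 = 3 := by
      show 2 * (Ls 0 : ℝ) * (1 / (Ls 0 : ℝ)) + 1 = 3
      have := (hLr 0).ne'
      field_simp; ring
    have h1 : 2 * (Ls 1 : ℝ) * r 1 + 1 = 3 := by
      show 2 * (Ls 1 : ℝ) * (1 / (Ls 1 : ℝ)) + 1 = 3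
      have := (hLr 1).ne'
      field_simp; ring
    have h2 : r 2 = ρ := rfl
    rw [h0, h1, h2]
  -- `|G| ≥ L·L·L₂`
  have hG : (Ls 0 : ℝ) * (Ls 0 : ℝ) * (Ls 2 : ℝ) ≤ Fintype.card G := by
    have : ∏ i, (Ls i : ℝ) = (Ls 0 : ℝ) * (Ls 0 : ℝ) * (Ls 2 : ℝ) := by
      rw [Fin.prod_univ_three, hL01]
    rw [← this]; exact hcard
  have hcardpos : (0 : ℝ) < Fintype.card G := Nat.cast_pos.mpr Fintype.card_pos
  have hL0 := hLr 0
  have hL2 := hLr 2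
  calc (Fintype.card G : ℝ)⁻¹ * ((Finset.univ.filter fun ψ : AddChar G ℂ =>
        addCharIndex (Ls 0) (e 0) ψ = 0 ∧ addCharIndex (Ls 1) (e 1) ψ = 0 ∧
          |addCharMomentum (Ls 2) (e 2) ψ| < ρ).card : ℝ)
      ≤ (Fintype.card G : ℝ)⁻¹ * (3 * 3 * (2 * (Ls 2 : ℝ) * ρ + 1)) := by
        rw [← hprod]
        gcongr
        exact le_trans (by exact_mod_cast Finset.card_le_card hsub) hcount
    _ ≤ ((Ls 0 : ℝ) * (Ls 0 : ℝ) * (Ls 2 : ℝ))⁻¹ * (3 * 3 * (2 * (Ls 2 : ℝ) * ρ + 1)) := by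
        gcongr
    _ = 9 * (2 * ρ + 1 / (Ls 2 : ℝ)) / (Ls 0 : ℝ) ^ 2 := by
        field_simp
        ring
    _ ≤ 9 * (3 * ρ) / (Ls 0 : ℝ) ^ 2 := by gcongr; linarith
    _ = 27 * ρ / (Ls 0 : ℝ) ^ 2 := by ring

/-! ### The averaged bounds -/

section Averages

variable {A : _root_.Matrix G G ℝ}

omit [DecidableEq G] in
/-- The off-zero-mode shells: `Σ_j B^{off}_j · |G|⁻¹#{|t|_∞ < 2^{j+1}/L} ≤ 2C₁ (L/2^N)^{2m}/L^{k+1}`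
(`shellTerm_le` at scale `L`, times the symbol ratio `(L/2^N)^{2m}`). [folklore] -/
theorem offZero_shellSum_le
    (e : Fin 3 → G) (Ls : Fin 3 → ℕ) (hL : ∀ i, Ls i ≠ 0) (he : ∀ i, Ls i • e i = 0)
    (hgen : ∀ ψ φ : AddChar G ℂ, (∀ i, ψ (e i) = φ (e i)) → ψ = φ)
    (hcard : ∏ i, (Ls i : ℝ) ≤ Fintype.card G) (hL01 : Ls 1 = Ls 0)
    {c₀ : ℝ} (hc₀ : 0 < c₀) {m k : ℕ} (hkm : k + 2 ≤ 2 * m) (N : ℕ)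
    (hLT : Ls 0 ≤ 2 ^ N) (hTM : 2 ^ N ≤ Ls 2) (J : ℕ) :
    ∑ j ∈ Finset.range J, (2 * π * 2 ^ (j + 1) / (Ls 0 : ℝ)) ^ k
        * (m * π ^ (2 * m + 2) / (4 * ((2 : ℝ) ^ N) ^ (2 * m))
          * (((Ls 0 : ℝ)) ^ 2 / (16 * c₀ * ((2 : ℝ) ^ j) ^ 2)) ^ (m + 1))
        * ((Fintype.card G : ℝ)⁻¹ * ((Finset.univ.filter fun ψ : AddChar G ℂ =>
            ∀ i, |addCharMomentum (Ls i) (e i) ψ| < 2 ^ (j + 1) / (Ls 0 : ℝ)).card : ℝ))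
      ≤ 27 * m * (2 * π) ^ k * π ^ (2 * m + 2) * 2 ^ (k + 4) / (4 * (16 * c₀) ^ (m + 1))
          * ((Ls 0 : ℝ) / 2 ^ N) ^ (2 * m) / (Ls 0 : ℝ) ^ (k + 1) := by
  set Lr : ℝ := (Ls 0 : ℝ) with hLr
  set T : ℝ := 2 ^ N with hT
  have hLpos : 0 < Lr := Nat.cast_pos.mpr (Nat.pos_of_ne_zero (hL 0))
  have hTpos : 0 < T := by positivity
  have hLrs : ∀ i, (0 : ℝ) < Ls i := fun i => Nat.cast_pos.mpr (Nat.pos_of_ne_zero (hL i))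
  have hLle : ∀ i, Lr ≤ (Ls i : ℝ) := by
    intro i; fin_cases i
    · exact le_rfl
    · simp [hLr, hL01]
    · calc Lr ≤ T := by rw [hLr, hT]; exact_mod_cast hLT
        _ ≤ (Ls 2 : ℝ) := by rw [hT]; exact_mod_cast hTM
  set C₁ : ℝ := 27 * m * (2 * π) ^ k * π ^ (2 * m + 2) * 2 ^ (k + 3) / (4 * (16 * c₀) ^ (m + 1)) with hC₁
  have hC₁0 : 0 ≤ C₁ := by rw [hC₁]; positivity
  -- counts
  have hcj : ∀ j, (Fintype.card G : ℝ)⁻¹ * ((Finset.univ.filter fun ψ : AddChar G ℂ =>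
      ∀ i, |addCharMomentum (Ls i) (e i) ψ| < 2 ^ (j + 1) / Lr).card : ℝ)
        ≤ (3 * (2 ^ (j + 1) / Lr)) ^ 3 := by
    intro j
    have hρ : (0 : ℝ) < 2 ^ (j + 1) / Lr := by positivity
    have h1 := card_filter_momentum_lt_le e Ls hL he hgen hρ
    calc (Fintype.card G : ℝ)⁻¹ * _
        ≤ (Fintype.card G : ℝ)⁻¹ * ∏ i, (2 * (Ls i : ℝ) * (2 ^ (j + 1) / Lr) + 1) := by gcongr
      _ ≤ ∏ i, (2 * (2 ^ (j + 1) / Lr) + 1 / (Ls i : ℝ)) := inv_card_mul_prod_le hLrs hcard hρ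
      _ ≤ (3 * (2 ^ (j + 1) / Lr)) ^ 3 := by
          refine prod_two_mul_add_inv_le hLpos hLle ?_
          rw [div_le_div_iff_of_pos_right hLpos]
          have : (1 : ℝ) ≤ 2 ^ (j + 1) := one_le_pow₀ (by norm_num)
          linarith
  -- the symbol ratio `(L/T)^{2m}`
  have hY : (m * π ^ (2 * m + 2) / (4 * T ^ (2 * m)) : ℝ)
      = (Lr / T) ^ (2 * m) * (m * π ^ (2 * m + 2) / (4 * Lr ^ (2 * m))) := by
    have hL2m : Lr ^ (2 * m) ≠ 0 := pow_ne_zero _ hLpos.ne'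
    have hT2m : T ^ (2 * m) ≠ 0 := pow_ne_zero _ hTpos.ne'
    rw [div_pow]; field_simp
  -- termwise
  have hterm : ∀ j, (2 * π * 2 ^ (j + 1) / Lr) ^ k
        * (m * π ^ (2 * m + 2) / (4 * T ^ (2 * m)) * (Lr ^ 2 / (16 * c₀ * ((2 : ℝ) ^ j) ^ 2)) ^ (m + 1))
        * ((Fintype.card G : ℝ)⁻¹ * ((Finset.univ.filter fun ψ : AddChar G ℂ =>
            ∀ i, |addCharMomentum (Ls i) (e i) ψ| < 2 ^ (j + 1) / Lr).card : ℝ))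
      ≤ (Lr / T) ^ (2 * m) * (C₁ * (1 / 2) ^ j / Lr ^ (k + 1)) := by
    intro j
    have hB0 : 0 ≤ (2 * π * 2 ^ (j + 1) / Lr) ^ k
        * (m * π ^ (2 * m + 2) / (4 * T ^ (2 * m)) * (Lr ^ 2 / (16 * c₀ * ((2 : ℝ) ^ j) ^ 2)) ^ (m + 1)) := by
      positivity
    calc _ ≤ (2 * π * 2 ^ (j + 1) / Lr) ^ k
          * (m * π ^ (2 * m + 2) / (4 * T ^ (2 * m)) * (Lr ^ 2 / (16 * c₀ * ((2 : ℝ) ^ j) ^ 2)) ^ (m + 1))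
          * (3 * (2 ^ (j + 1) / Lr)) ^ 3 := mul_le_mul_of_nonneg_left (hcj j) hB0
      _ = (Lr / T) ^ (2 * m) * ((2 * π * 2 ^ (j + 1) / Lr) ^ k
          * (m * π ^ (2 * m + 2) / (4 * Lr ^ (2 * m)) * (Lr ^ 2 / (16 * c₀ * ((2 : ℝ) ^ j) ^ 2)) ^ (m + 1))
          * (3 * (2 ^ (j + 1) / Lr)) ^ 3) := by rw [hY]; ring
      _ ≤ (Lr / T) ^ (2 * m) * (C₁ * (1 / 2) ^ j / Lr ^ (k + 1)) := by
          refine mul_le_mul_of_nonneg_left ?_ (by positivity)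
          rw [hC₁]
          exact shellTerm_le hc₀ hLpos hkm j
  calc _ ≤ ∑ j ∈ Finset.range J, (Lr / T) ^ (2 * m) * (C₁ * (1 / 2) ^ j / Lr ^ (k + 1)) :=
        Finset.sum_le_sum fun j _ => hterm j
    _ = (Lr / T) ^ (2 * m) * C₁ / Lr ^ (k + 1) * ∑ j ∈ Finset.range J, (1 / 2 : ℝ) ^ j := by
        rw [Finset.mul_sum]
        exact Finset.sum_congr rfl fun j _ => by ring
    _ ≤ (Lr / T) ^ (2 * m) * C₁ / Lr ^ (k + 1) * 2 :=
        mul_le_mul_of_nonneg_left (sum_geometric_two_le J) (by positivity)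
    _ = 27 * m * (2 * π) ^ k * π ^ (2 * m + 2) * 2 ^ (k + 4) / (4 * (16 * c₀) ^ (m + 1))
        * (Lr / T) ^ (2 * m) / Lr ^ (k + 1) := by
        rw [hC₁, show (2 : ℝ) ^ (k + 4) = 2 ^ (k + 3) * 2 by ring]
        ring

end Averages

end Literature.Analysis.Matrix
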